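import Mathlib
import HarnessLib
import Literature.Geometry.DiscreteGeometry.ConvexHullFacets

/-!
# Bond triangles of the twelve link directions are facets of their hull

Route `PricedLinkCensus`, item `SoftFourRings` (stmt-AtomisticToContinuum-14234), evidence
`softrings-search.md` §12.  Three pairwise bonded unit directions `u, v, w` (inner products in
`[cb, ca]`) among a `ca`-separated set `X` of unit vectors span a FACET of `conv X` with exactly these
three vertices, as soon as `0 ≤ cb ≤ ca`, `2 ca < 1 + cb` and `3 ca < 1 + 2 cb` (at `η = 1/100`:
`1.02 < 1.49`, `1.53 < 1.98`).  The facet functional is the circumcentre functional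
`c = α u + β v + γ w`, `⟪c, u⟫ = ⟪c, v⟫ = ⟪c, w⟫ = 1`, solved by Cramer's rule on the Gram matrix:
with `p = ⟪u, v⟫`, `q = ⟪u, w⟫`, `r = ⟪v, w⟫` and `D = 1 + 2pqr − p² − q² − r²`,
`α = (1 − r)(1 + r − p − q)/D` etc.; the identity
`D = (1 − r)(1 + r − p − q) + p (1 − q)(1 + q − p − r) + q (1 − p)(1 + p − q − r)` shows `D > 0` and
`α, β, γ > 0`, and summing the three equations gives `α + β + γ ≤ 3/(1 + 2 cb)`, whence every other
point `y ∈ X` has `⟪c, y⟫ ≤ 3 ca/(1 + 2 cb) < 1`: the circumscribed cap of a bond triangle is empty and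
no fourth point of `X` is cocircular with it (`bond_triangle_facet`).  In the face bookkeeping of
`Literature.Geometry.DiscreteGeometry.SphericalCodeHullEuler*` this makes the bond triangles of the
link graph facets with `#(tightSet X c) = 3`.
-/

namespace Summit.AtomisticToContinuum.Crystallization.Theorems

open Real RealInnerProductSpace Literature.Geometry.DiscreteGeometry Module

/-- **The circumcentre functional of a bond triangle** (Cramer's rule on the Gram matrix).  For unit
`u, v, w` with pairwise inner products in `[cb, ca]`, `0 ≤ cb`, `2 ca < 1 + cb`: there are
`α, β, γ > 0` with `α + β + γ ≤ 3/(1 + 2 cb)` such that `c = α u + β v + γ w` satisfies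
`⟪c, u⟫ = ⟪c, v⟫ = ⟪c, w⟫ = 1`; moreover the Gram determinant is positive, recorded as: any
`a u + b v + c w = 0` has `a = b = c = 0`. [folklore] -/
theorem bond_triangle_functional {ca cb : ℝ} (hcb0 : 0 ≤ cb) (h2 : 2 * ca < 1 + cb)
    {u v w : EuclideanSpace ℝ (Fin 3)} (hu : ‖u‖ = 1) (hv : ‖v‖ = 1) (hw : ‖w‖ = 1)
    (huv : cb ≤ ⟪u, v⟫) (huv' : ⟪u, v⟫ ≤ ca) (huw : cb ≤ ⟪u, w⟫) (huw' : ⟪u, w⟫ ≤ ca)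
    (hvw : cb ≤ ⟪v, w⟫) (hvw' : ⟪v, w⟫ ≤ ca) :
    (∃ α β γ : ℝ, 0 < α ∧ 0 < β ∧ 0 < γ ∧ α + β + γ ≤ 3 / (1 + 2 * cb) ∧
      ⟪α • u + β • v + γ • w, u⟫ = 1 ∧ ⟪α • u + β • v + γ • w, v⟫ = 1 ∧
      ⟪α • u + β • v + γ • w, w⟫ = 1) ∧
    (∀ a b e : ℝ, a • u + b • v + e • w = 0 → a = 0 ∧ b = 0 ∧ e = 0) := by
  obtain ⟨p, hp⟩ : ∃ P : ℝ, P = ⟪u, v⟫ := ⟨_, rfl⟩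
  obtain ⟨q, hq⟩ : ∃ Q : ℝ, Q = ⟪u, w⟫ := ⟨_, rfl⟩
  obtain ⟨r, hr⟩ : ∃ R : ℝ, R = ⟪v, w⟫ := ⟨_, rfl⟩
  have huu : ⟪u, u⟫ = 1 := by rw [real_inner_self_eq_norm_sq, hu]; norm_num
  have hvv : ⟪v, v⟫ = 1 := by rw [real_inner_self_eq_norm_sq, hv]; norm_num
  have hww : ⟪w, w⟫ = 1 := by rw [real_inner_self_eq_norm_sq, hw]; norm_num
  have hvu : ⟪v, u⟫ = p := by rw [real_inner_comm]; exact hp.symm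
  have hwu : ⟪w, u⟫ = q := by rw [real_inner_comm]; exact hq.symm
  have hwv : ⟪w, v⟫ = r := by rw [real_inner_comm]; exact hr.symm
  rw [← hp] at huv huv'
  rw [← hq] at huw huw'
  rw [← hr] at hvw hvw'
  -- the three Cramer numerators are positive, and so is the Gram determinant
  have hA : 0 < (1 - r) * (1 + r - p - q) := mul_pos (by linarith) (by linarith)
  have hB : 0 < (1 - q) * (1 + q - p - r) := mul_pos (by linarith) (by linarith)
  have hC : 0 < (1 - p) * (1 + p - q - r) := mul_pos (by linarith) (by linarith)
  set D : ℝ := 1 + 2 * p * q * r - p ^ 2 - q ^ 2 - r ^ 2 with hD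
  have hDid : D = (1 - r) * (1 + r - p - q) + p * ((1 - q) * (1 + q - p - r)) +
      q * ((1 - p) * (1 + p - q - r)) := by rw [hD]; ring
  have hD0 : 0 < D := by
    rw [hDid]
    have := mul_nonneg (le_trans hcb0 huv) hB.le
    have := mul_nonneg (le_trans hcb0 huw) hC.le
    linarith
  refine ⟨⟨(1 - r) * (1 + r - p - q) / D, (1 - q) * (1 + q - p - r) / D,
    (1 - p) * (1 + p - q - r) / D, div_pos hA hD0, div_pos hB hD0, div_pos hC hD0, ?_, ?_, ?_, ?_⟩,
    ?_⟩
  · -- sum bound: `(α + β + γ)(1 + 2 cb) ≤ α(1+p+q) + β(1+p+r) + γ(1+q+r) = 3`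
    have h12 : 0 < 1 + 2 * cb := by linarith
    have hsum : ((1 - r) * (1 + r - p - q)) * (1 + p + q) + ((1 - q) * (1 + q - p - r)) *
        (1 + p + r) + ((1 - p) * (1 + p - q - r)) * (1 + q + r) = 3 * D := by
      rw [hD]; ring
    have key : ((1 - r) * (1 + r - p - q) + (1 - q) * (1 + q - p - r) +
        (1 - p) * (1 + p - q - r)) * (1 + 2 * cb) ≤ 3 * D := by
      nlinarith [mul_le_mul_of_nonneg_left (show 1 + 2 * cb ≤ 1 + p + q by linarith) hA.le,
        mul_le_mul_of_nonneg_left (show 1 + 2 * cb ≤ 1 + p + r by linarith) hB.le,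
        mul_le_mul_of_nonneg_left (show 1 + 2 * cb ≤ 1 + q + r by linarith) hC.le]
    have hfr : (1 - r) * (1 + r - p - q) / D + (1 - q) * (1 + q - p - r) / D +
        (1 - p) * (1 + p - q - r) / D = ((1 - r) * (1 + r - p - q) + (1 - q) * (1 + q - p - r) +
        (1 - p) * (1 + p - q - r)) / D := by ring
    rw [hfr, div_le_div_iff₀ hD0 h12]
    linarith [key]
  · rw [inner_add_left, inner_add_left, real_inner_smul_left, real_inner_smul_left,
      real_inner_smul_left, huu, hvu, hwu]
    field_simp
    rw [hD]; ring
  · rw [inner_add_left, inner_add_left, real_inner_smul_left, real_inner_smul_left,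
      real_inner_smul_left, ← hp, hvv, hwv]
    field_simp
    rw [hD]; ring
  · rw [inner_add_left, inner_add_left, real_inner_smul_left, real_inner_smul_left,
      real_inner_smul_left, ← hq, ← hr, hww]
    field_simp
    rw [hD]; ring
  · -- Gram determinant `D ≠ 0`: adjugate combinations of the three scalar equations
    intro a b e h
    have h1 : a + b * p + e * q = 0 := by
      have := congrArg (fun z => ⟪z, u⟫) h
      simp only [inner_add_left, real_inner_smul_left, inner_zero_left, huu, hvu, hwu] at this
      linarith
    have h2' : a * p + b + e * r = 0 := by
      have := congrArg (fun z => ⟪z, v⟫) h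
      simp only [inner_add_left, real_inner_smul_left, inner_zero_left, hvv, hwv] at this
      rw [← hp] at this; linarith
    have h3 : a * q + b * r + e = 0 := by
      have := congrArg (fun z => ⟪z, w⟫) h
      simp only [inner_add_left, real_inner_smul_left, inner_zero_left, hww] at this
      rw [← hq, ← hr] at this; linarith
    have ha : a * D = 0 := by
      rw [hD]; linear_combination (1 - r ^ 2) * h1 + (q * r - p) * h2' + (p * r - q) * h3
    have hb : b * D = 0 := by
      rw [hD]; linear_combination (q * r - p) * h1 + (1 - q ^ 2) * h2' + (p * q - r) * h3
    have he : e * D = 0 := by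
      rw [hD]; linear_combination (p * r - q) * h1 + (p * q - r) * h2' + (1 - p ^ 2) * h3
    exact ⟨(mul_eq_zero.1 ha).resolve_right hD0.ne', (mul_eq_zero.1 hb).resolve_right hD0.ne',
      (mul_eq_zero.1 he).resolve_right hD0.ne'⟩

/-- **Bond triangles are facets.**  Let `0 ≤ cb ≤ ca`, `2 ca < 1 + cb`, `3 ca < 1 + 2 cb`; `X` a
finite set of unit vectors of `ℝ³` with pairwise inner products `≤ ca`; `u, v, w ∈ X` distinct and
pairwise bonded (`cb ≤ ⟪·, ·⟫`).  Then the circumcentre functional `c = α u + β v + γ w`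
(`α, β, γ > 0`) is a facet normal of `conv X` whose tight set is exactly `{u, v, w}`: the
circumscribed cap of a bond triangle contains no further point of `X`, not even on its boundary
(every other `y ∈ X` has `⟪c, y⟫ ≤ 3 ca/(1 + 2 cb) < 1`). [folklore] -/
theorem bond_triangle_facet {ca cb : ℝ} (hcb0 : 0 ≤ cb) (hcba : cb ≤ ca) (h2 : 2 * ca < 1 + cb)
    (h3 : 3 * ca < 1 + 2 * cb) {X : Finset (EuclideanSpace ℝ (Fin 3))} (hX1 : ∀ y ∈ X, ‖y‖ = 1)
    (hsep : ∀ y ∈ X, ∀ y' ∈ X, y ≠ y' → ⟪y, y'⟫ ≤ ca) {u v w : EuclideanSpace ℝ (Fin 3)}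
    (hu : u ∈ X) (hv : v ∈ X) (hw : w ∈ X) (huv0 : u ≠ v) (huw0 : u ≠ w) (hvw0 : v ≠ w)
    (huv : cb ≤ ⟪u, v⟫) (huw : cb ≤ ⟪u, w⟫) (hvw : cb ≤ ⟪v, w⟫) :
    ∃ c : EuclideanSpace ℝ (Fin 3), c ∈ facetNormals X ∧ tightSet X c = {u, v, w} ∧
      (∀ y ∈ X, y ≠ u → y ≠ v → y ≠ w → ⟪c, y⟫ ≤ 3 * ca / (1 + 2 * cb)) ∧
      ∃ α β γ : ℝ, 0 < α ∧ 0 < β ∧ 0 < γ ∧ c = α • u + β • v + γ • w := by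
  classical
  obtain ⟨⟨α, β, γ, hα, hβ, hγ, hsum, hcu, hcv, hcw⟩, hind⟩ :=
    bond_triangle_functional hcb0 h2 (hX1 u hu) (hX1 v hv) (hX1 w hw) huv (hsep u hu v hv huv0)
      huw (hsep u hu w hw huw0) hvw (hsep v hv w hw hvw0)
  set c : EuclideanSpace ℝ (Fin 3) := α • u + β • v + γ • w with hc
  have h12 : 0 < 1 + 2 * cb := by linarith
  have hca0 : 0 ≤ ca := le_trans hcb0 hcba
  have hlt1 : 3 * ca / (1 + 2 * cb) < 1 := by rw [div_lt_one h12]; exact h3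
  -- every other point is strictly below level 1
  have hother : ∀ y ∈ X, y ≠ u → y ≠ v → y ≠ w → ⟪c, y⟫ ≤ 3 * ca / (1 + 2 * cb) := by
    intro y hy hyu hyv hyw
    rw [hc, inner_add_left, inner_add_left, real_inner_smul_left, real_inner_smul_left,
      real_inner_smul_left]
    have h1 := hsep u hu y hy (Ne.symm hyu)
    have h2 := hsep v hv y hy (Ne.symm hyv)
    have h3 := hsep w hw y hy (Ne.symm hyw)
    calc α * ⟪u, y⟫ + β * ⟪v, y⟫ + γ * ⟪w, y⟫ ≤ α * ca + β * ca + γ * ca := by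
          nlinarith [mul_le_mul_of_nonneg_left h1 hα.le, mul_le_mul_of_nonneg_left h2 hβ.le,
            mul_le_mul_of_nonneg_left h3 hγ.le]
      _ = (α + β + γ) * ca := by ring
      _ ≤ 3 / (1 + 2 * cb) * ca := mul_le_mul_of_nonneg_right hsum hca0
      _ = 3 * ca / (1 + 2 * cb) := by ring
  have hle1 : ∀ y ∈ X, ⟪c, y⟫ ≤ 1 := by
    intro y hy
    by_cases hyu : y = u
    · rw [hyu, hcu]
    by_cases hyv : y = v
    · rw [hyv, hcv]
    by_cases hyw : y = w
    · rw [hyw, hcw]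
    linarith [hother y hy hyu hyv hyw]
  -- the tight set
  have htight : tightSet X c = {u, v, w} := by
    ext y
    rw [mem_tightSet, Finset.mem_insert, Finset.mem_insert, Finset.mem_singleton]
    constructor
    · rintro ⟨hy, hy1⟩
      by_contra hne
      push Not at hne
      obtain ⟨hyu, hyv, hyw⟩ := hne
      linarith [hother y hy hyu hyv hyw]
    · rintro (rfl | rfl | rfl)
      · exact ⟨hu, hcu⟩
      · exact ⟨hv, hcv⟩
      · exact ⟨hw, hcw⟩
  -- the tight set spans `ℝ³`
  have hli : LinearIndependent ℝ ![u, v, w] := by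
    rw [Fintype.linearIndependent_iff]
    intro g hg i
    rw [Fin.sum_univ_three] at hg
    simp only [Matrix.cons_val_zero, Matrix.cons_val_one, Matrix.cons_val] at hg
    obtain ⟨h0, h1, h2'⟩ := hind (g 0) (g 1) (g 2) hg
    fin_cases i
    · exact h0
    · exact h1
    · exact h2'
  have hspan3 : Submodule.span ℝ (Set.range ![u, v, w]) = ⊤ :=
    hli.span_eq_top_of_card_eq_finrank (by rw [finrank_euclideanSpace_fin]; simp)
  have hrange : Set.range ![u, v, w] ⊆ ((tightSet X c : Finset _) : Set (EuclideanSpace ℝ (Fin 3))) := by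
    rintro y ⟨i, rfl⟩
    rw [htight, Finset.coe_insert, Finset.coe_insert, Finset.coe_singleton]
    fin_cases i <;> simp
  have hspan : Submodule.span ℝ ((tightSet X c : Finset _) : Set (EuclideanSpace ℝ (Fin 3))) = ⊤ := by
    apply top_le_iff.1
    rw [← hspan3]
    exact Submodule.span_mono hrange
  refine ⟨c, mem_facetNormals.2 ⟨hle1, hspan⟩, htight, hother, α, β, γ, hα, hβ, hγ, rfl⟩

/-- `bond_triangle_facet` at `η = 1/100`: with `ca = 1 − 1/(2·(101/100)²)`, `cb = 1 − (101/100)²/2`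
(the angular window of the soft link, `Reduction`), every bonded triple of a `ca`-separated set of unit
vectors spans a facet with exactly three vertices; every other point has `⟪c, y⟫ ≤ 0.7726`. [folklore] -/
theorem bond_triangle_facet_one_percent {X : Finset (EuclideanSpace ℝ (Fin 3))}
    (hX1 : ∀ y ∈ X, ‖y‖ = 1)
    (hsep : ∀ y ∈ X, ∀ y' ∈ X, y ≠ y' → ⟪y, y'⟫ ≤ 1 - 1 / (2 * (101 / 100 : ℝ) ^ 2))
    {u v w : EuclideanSpace ℝ (Fin 3)} (hu : u ∈ X) (hv : v ∈ X) (hw : w ∈ X) (huv0 : u ≠ v)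
    (huw0 : u ≠ w) (hvw0 : v ≠ w) (huv : 1 - (101 / 100 : ℝ) ^ 2 / 2 ≤ ⟪u, v⟫)
    (huw : 1 - (101 / 100 : ℝ) ^ 2 / 2 ≤ ⟪u, w⟫) (hvw : 1 - (101 / 100 : ℝ) ^ 2 / 2 ≤ ⟪v, w⟫) :
    ∃ c : EuclideanSpace ℝ (Fin 3), c ∈ facetNormals X ∧ tightSet X c = {u, v, w} ∧
      (∀ y ∈ X, y ≠ u → y ≠ v → y ≠ w →
        ⟪c, y⟫ ≤ 3 * (1 - 1 / (2 * (101 / 100 : ℝ) ^ 2)) / (1 + 2 * (1 - (101 / 100 : ℝ) ^ 2 / 2))) ∧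
      ∃ α β γ : ℝ, 0 < α ∧ 0 < β ∧ 0 < γ ∧ c = α • u + β • v + γ • w :=
  bond_triangle_facet (by norm_num) (by norm_num) (by norm_num) (by norm_num) hX1 hsep hu hv hw huv0
    huw0 hvw0 huv huw hvw

end Summit.AtomisticToContinuum.Crystallization.Theorems
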